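import Summits.QuantumFields.BalabanUV.Beta.D1BFx.ReducedKernel
import Summits.QuantumFields.BalabanUV.Beta.D1BFx.GhostLeg

/-!
# `BalabanUV.Beta.D1BFx.ReducedKernelF` — road «BF-x» for binder row D1, typer object T8 (generic fibre + GHOST instance): the dressed
# one-shot kernel `TOfLeg n A S W := hessKer A (vertexRedF n S) W` over ANY leg `A : MKer 4 F` on ANY fibre `F`, the chain-rule vertex dressed
# by the minimiser response `wH`; `D1BFx.ReducedKernel` (gluon, `F = Fin 4`, `A = Ga n a`) is the `rfl`-instance, and the GHOST instance
# `TOfGh n a := TOfLeg n (Ggh n a)` over the typer's T2 `Ggh` carries its leg-side decay UNCONDITIONALLY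

HONEST FRAMING (cell contract, verbatim): «discharging `BetaPertH` makes Bałaban's UV stability UNCONDITIONAL — a real constructive-QFT
result; it is NOT the continuum limit and NOT the Clay problem.»  HONEST DEPENDENCY (verbatim): «continuum YM on T⁴ ⇐ BetaPertH ∧ nine
spine estimates (0/9 proved); BetaPertH ⇐ (D1) ∧ (D4) ∧ CAP+tail; G-an2-4 gates asym, D1 and NE2/3/4.»  THIS MODULE DISCHARGES NOTHING.
Three definitions with bodies (generic reduced vertex, generic dressed kernel, ghost abbreviation) and [folklore] bookkeeping composed BY
NAME (`OneStepResolventKernel.biLoc_wsum`/`biLoc_finset_sum`/`wsum_shift`, `KernelSpecInstance.decay_wH`, `ExpKernelCalculus.hess_eq_hessKer`/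
`absMoment₂_hessKer`, `HessKerRate.decay510_hessKer_explicit`, `B12Sec2to5.secondMoment_abs_le_of_decay510`, the typer's
`D1BFx.GhostLeg.decays_Ggh`/`shiftK_Ggh_neg`).  No `Prop` is minted; nothing printed is asserted; 0 sorry.  NOT summit progress.

ABSOLUTE RULE (cell, verbatim): «No internally-minted statement may enter as a cited fact. Every hypothesis is either kernel-proved in this
package or a verbatim quotation of a PUBLISHED theorem with page reference. The manuscript(s) under audit are NOT citable for their own
disputed steps — they are the thing under adjudication; programme-internal (2001/route/tribunal) claims are never citable.»

WHY (skeleton `HOME/beta/skeletons/D1-b2b-balaban-beta-d1-p2.md` v1.4 node O, TYPER-SPEC §1 T7/T8).  T7 wants TWO fine kernels: `Pgl` over the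
gluon leg (= `ReducedKernel.TOfRed n a Sbf Wbf`) and `Pgh` over the GHOST leg «likewise, with loop weight `(+1)`».  Rather than copy T8 for the
fibre `Unit`, this file states T8 ONCE for any fibre and any leg and instantiates: gluon = the landed `ReducedKernel` by `rfl`
(`vertexRed_eq_vertexRedF`, `TOfRed_eq_TOfLeg`), ghost = `TOfGh`.  The GHOST leg's decay is a TREE THEOREM (`GhostLeg.decays_Ghh`-type:
`Decays (Ggh n a) (2/min 2 a) (δ_u(4,a)/(4n))`, every `a > 0`), so the ghost kernel's (5.10)-shape decay and well-typedness (`AbsMoment₂`)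
carry NO leg-side binder — unlike the gluon kernel, whose `Decays (Ga n a) C δ` is an (α)-input.  HONEST: the ghost rate is `∝ 1/n`, so the
constants below are PER `n`; no `n`-uniformity is claimed (the ghost loop belongs to the MAIN term, exponent `p = 0`, node A).  The loop
weight/sign of `Pgh` (leaf R1) is NOT fixed here: T7 applies the scalar, and scalars preserve every statement below.

CONTENT (all [folklore] / [our object]).
* §1 `vertexRedF`, `TOfLeg`, unfolding lemmas, and the bridges to `ReducedKernel` (`rfl`).
* §2 generic structure: `vertexFamily_vertexRedF` (explicit), `vertexFamily_vertexRedF'` (∃), `vertexRedF_translate`, `blockCovariant_TOfLeg`,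
  `hess_eq_TOfLeg`; under `Decays A C δ`: `decay510_TOfLeg` (constant `hessConst 4 |F| δ C Cv Cw`), `abs_secondMoment_TOfLeg_le`, `absMoment₂_TOfLeg`.
* §3 GHOST instance `TOfGh n a S W := TOfLeg n (Ggh n a) S W`: `blockCovariant_TOfGh`, `hess_Ggh_eq_TOfGh`, `decay510_TOfGh`, `absMoment₂_TOfGh`
  (`0 < a`; vertex families at any positive rates; NO leg-side hypothesis).
-/

noncomputable section

namespace Summit.QuantumFields.BalabanUV.Beta.D1BFx.ReducedKernelF

open Finset
open Literature.MathematicalPhysics.QuantumFieldTheory.Balaban1983to89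
open Literature.MathematicalPhysics.QuantumFieldTheory.Balaban1983to89.Beta
open B12Sec2to5 (l1 l1_nonneg Decay510 betaPrime510 secondMoment_abs_le_of_decay510)
open B6QGQDecay237 (deltaU deltaU_pos)
open ExpKernelCalculus (Site MKer Decays BiLoc VertexFamily VertexFamily₂ shiftK BlockCovariant hess hessKer hess_eq_hessKer Zl
  absMoment₂_hessKer)
open DecimatedMomentSummable (AbsMoment₂)
open KernelSpecInstance (wH decay_wH)
open OneStepResolventKernel (wsum biLoc_wsum biLoc_finset_sum wsum_shift bound_mono decays_mono biLoc_mono)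
open HessKerRate (hessConst decay510_hessKer_explicit)
open Summit.QuantumFields.BalabanUV.Beta.D1BFx.GluonLeg (Ga)
open Summit.QuantumFields.BalabanUV.Beta.D1BFx.ReducedKernel (StencilR TableR vertexRed TOfRed)
open Summit.QuantumFields.BalabanUV.Beta.D1BFx.GhostLeg (Ggh decays_Ggh shiftK_Ggh_neg const_nonneg)

variable {F : Type*} [Fintype F]

/-! ## §1 The generic objects and the bridges to the gluon instance -/

/-- [our object] **THE REDUCED CHAIN-RULE VERTEX ON ANY FIBRE** (blocking `n`): `Σ_{κ′} Σ'_u wH κ′ μ (u − n•y) · S κ′ u` — VERBATIM the body of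
`OneStepResolventKernel.vertexOf` / `ReducedKernel.vertexRed`, the stencil family now valued in `MKer 4 F`.  A DEFINITION. -/
def vertexRedF (n : ℕ) [NeZero n] (S : Fin 4 → Site 4 → MKer 4 F) (μ : Fin 4) (y : Site 4) : MKer 4 F :=
  fun x z a b => ∑ κ' : Fin 4, wsum (fun u => wH (N := n) (d := 3) κ' μ (u - (n : ℤ) • y)) (S κ') x z a b

/-- [our object] **THE DRESSED ONE-SHOT KERNEL OVER ANY LEG** `A : MKer 4 F`: `TOfLeg n A S W := hessKer A (vertexRedF n S) W`.  A DEFINITION;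
asserts nothing. -/
def TOfLeg (n : ℕ) [NeZero n] (A : MKer 4 F) (S : Fin 4 → Site 4 → MKer 4 F) (W : Fin 4 → Site 4 → Fin 4 → Site 4 → MKer 4 F) :
    Fin 4 → Fin 4 → Site 4 → ℝ :=
  hessKer A (vertexRedF n S) W

variable (n : ℕ) [NeZero n]

omit [Fintype F] in
/-- [our object] Unfolding `vertexRedF`. -/
theorem vertexRedF_apply (S : Fin 4 → Site 4 → MKer 4 F) (μ : Fin 4) (y : Site 4) (x z : Site 4) (a b : F) :
    vertexRedF n S μ y x z a b = ∑ κ' : Fin 4, wsum (fun u => wH (N := n) (d := 3) κ' μ (u - (n : ℤ) • y)) (S κ') x z a b := rfl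

/-- [our object] Unfolding `TOfLeg`. -/
theorem TOfLeg_eq (A : MKer 4 F) (S : Fin 4 → Site 4 → MKer 4 F) (W : Fin 4 → Site 4 → Fin 4 → Site 4 → MKer 4 F) :
    TOfLeg n A S W = hessKer A (vertexRedF n S) W := rfl

/-- [folklore] BRIDGE: T8's gluon vertex is the `Fin 4` instance, definitionally. -/
theorem vertexRed_eq_vertexRedF (S : StencilR) : vertexRed n S = vertexRedF n S := rfl

/-- [folklore] BRIDGE: T8's `TOfRed n a S W = TOfLeg n (Ga n a) S W`, definitionally. -/
theorem TOfRed_eq_TOfLeg (a : ℝ) (S : StencilR) (W : TableR) : TOfRed n a S W = TOfLeg n (Ga n a) S W := rfl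

/-! ## §2 Generic structure: vertex family, covariance, decay under a leg-decay hypothesis -/

section Generic

variable {S : Fin 4 → Site 4 → MKer 4 F} {W : Fin 4 → Site 4 → Fin 4 → Site 4 → MKer 4 F} {A : MKer 4 F}

omit [Fintype F] in
/-- [folklore] **THE REDUCED CHAIN-RULE VERTEX IS A VERTEX FAMILY** (explicit constants; the `vertexFamily_vertexOf` proof on the fibre `F`). -/
theorem vertexFamily_vertexRedF {Cs δ : ℝ} (hS : ∀ κ' u, BiLoc (S κ' u) u u Cs δ) (hδ : 0 < δ) {Cw δw : ℝ}
    (hCw : 0 ≤ Cw) (hδw : δ ≤ δw) (hwH : ∀ κ l : Fin 4, Decay510 (wH (N := n) (d := 3) κ l) Cw δw) :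
    VertexFamily (vertexRedF n S) n ((4 : ℕ) * (Cw * Cs * Zl 4 (δ / 2))) (δ / 2) := by
  intro μ y
  have hterm : ∀ κ' : Fin 4, BiLoc (wsum (fun u => wH (N := n) (d := 3) κ' μ (u - (n : ℤ) • y)) (S κ'))
      ((n : ℤ) • y) ((n : ℤ) • y) (Cw * Cs * Zl 4 (δ / 2)) (δ / 2) := by
    intro κ'
    refine biLoc_wsum (fun u => ?_) (fun u => hS κ' u) hδ hCw
    exact bound_mono (hwH κ' μ (u - (n : ℤ) • y)) hCw le_rfl hδw (l1_nonneg _)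
  have hsum := biLoc_finset_sum (Finset.univ : Finset (Fin 4)) (fun κ' _ => hterm κ')
  simp only [Finset.sum_const, Finset.card_univ, Fintype.card_fin, nsmul_eq_mul] at hsum
  exact hsum

omit [Fintype F] in
/-- [folklore] The packaged form (∃ constant and rate, via `KernelSpecInstance.decay_wH`; needs the fibre inhabited to read `0 ≤ Cs`). -/
theorem vertexFamily_vertexRedF' [Inhabited F] {Cs δ : ℝ} (hS : ∀ κ' u, BiLoc (S κ' u) u u Cs δ) (hδ : 0 < δ) :
    ∃ Cv δv : ℝ, 0 < δv ∧ δv ≤ δ ∧ VertexFamily (vertexRedF n S) n Cv δv := by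
  obtain ⟨δw, Cw, hδw, hwH⟩ := decay_wH (N := n) (d := 3)
  have hCw : 0 ≤ Cw := by
    have h0 := hwH 0 0 0
    simp only [l1, Pi.zero_apply, Int.cast_zero, abs_zero, Finset.sum_const_zero, mul_zero, Real.exp_zero, mul_one] at h0
    exact (abs_nonneg _).trans h0
  have hCs : 0 ≤ Cs := (hS 0 0).nonneg default
  have hS' : ∀ κ' u, BiLoc (S κ' u) u u Cs (min δ δw) := fun κ' u => biLoc_mono (hS κ' u) hCs (min_le_left _ _)
  refine ⟨_, _, half_pos (lt_min hδ hδw), ?_, vertexFamily_vertexRedF n hS' (lt_min hδ hδw) hCw (min_le_right _ _) hwH⟩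
  have := min_le_left δ δw
  linarith [hδ]

omit [Fintype F] in
/-- [folklore] **COVARIANCE** (`BlockCovariant.covV`) for a fine-translation-covariant stencil family. -/
theorem vertexRedF_translate (hS : ∀ (κ' : Fin 4) (u v : Site 4), S κ' (u + v) = shiftK (-v) (S κ' u)) (μ : Fin 4) (y t : Site 4) :
    vertexRedF n S μ (y + t) = shiftK (-((n : ℤ) • t)) (vertexRedF n S μ y) := by
  funext x z a b
  simp only [vertexRedF]
  have h : ∀ κ' : Fin 4, wsum (fun u => wH (N := n) (d := 3) κ' μ (u - (n : ℤ) • (y + t))) (S κ') =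
      shiftK (-((n : ℤ) • t)) (wsum (fun u => wH (N := n) (d := 3) κ' μ (u - (n : ℤ) • y)) (S κ')) := by
    intro κ'
    have hw : (fun u => wH (N := n) (d := 3) κ' μ (u - (n : ℤ) • (y + t))) =
        fun u => (fun u' => wH (N := n) (d := 3) κ' μ (u' - (n : ℤ) • y)) (u - (n : ℤ) • t) := by
      funext u
      simp only [smul_add]
      congr 1
      abel
    rw [hw]
    exact wsum_shift (fun u' => wH (N := n) (d := 3) κ' μ (u' - (n : ℤ) • y)) ((n : ℤ) • t) (fun u => hS κ' u ((n : ℤ) • t))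
  simp only [h, shiftK, vertexRedF]

omit [Fintype F] in
/-- [folklore] `BlockCovariant A (vertexRedF n S) W n` from the leg's `covA`, the stencils' fine covariance and the tables' block covariance. -/
theorem blockCovariant_TOfLeg (hA : ∀ t : Site 4, shiftK (-((n : ℤ) • t)) A = A)
    (hS : ∀ (κ' : Fin 4) (u v : Site 4), S κ' (u + v) = shiftK (-v) (S κ' u))
    (hW : ∀ (μ : Fin 4) (y : Site 4) (ν : Fin 4) (y' t : Site 4), W μ (y + t) ν (y' + t) = shiftK (-((n : ℤ) • t)) (W μ y ν y')) :
    BlockCovariant A (vertexRedF n S) W n :=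
  ⟨hA, fun μ y t => vertexRedF_translate n hS μ y t, hW⟩

/-- [folklore] **BASE POINT**: `hess A (vertexRedF n S) W μ y ν y′ = TOfLeg n A S W μ ν (y′ − y)` under block covariance. -/
theorem hess_eq_TOfLeg (hA : ∀ t : Site 4, shiftK (-((n : ℤ) • t)) A = A)
    (hS : ∀ (κ' : Fin 4) (u v : Site 4), S κ' (u + v) = shiftK (-v) (S κ' u))
    (hW : ∀ (μ : Fin 4) (y : Site 4) (ν : Fin 4) (y' t : Site 4), W μ (y + t) ν (y' + t) = shiftK (-((n : ℤ) • t)) (W μ y ν y'))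
    (μ : Fin 4) (y : Site 4) (ν : Fin 4) (y' : Site 4) :
    hess A (vertexRedF n S) W μ y ν y' = TOfLeg n A S W μ ν (y' - y) :=
  hess_eq_hessKer (blockCovariant_TOfLeg n hA hS hW) μ y ν y'

variable {C Cv Cw δ : ℝ}

/-- [folklore] **(5.10)-SHAPE DECAY, EXPLICIT CONSTANT**, given `Decays A C δ` and vertex/table data at the common rate `δ`:
`Decay510 (TOfLeg n A S W μ ν) (hessConst 4 |F| δ C Cv Cw) (δ/4)`. -/
theorem decay510_TOfLeg (hn : 1 ≤ n) (hA : Decays A C δ) (hV : VertexFamily (vertexRedF n S) n Cv δ) (hW : VertexFamily₂ W n Cw δ)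
    (hδ : 0 < δ) (μ ν : Fin 4) :
    Decay510 (TOfLeg n A S W μ ν) (hessConst 4 (Fintype.card F) δ C Cv Cw) (δ / 4) :=
  decay510_hessKer_explicit hA hV hW hδ hn μ ν

/-- [folklore] The (1.22)-moment bound with the explicit constant. -/
theorem abs_secondMoment_TOfLeg_le (hn : 1 ≤ n) (hA : Decays A C δ) (hV : VertexFamily (vertexRedF n S) n Cv δ)
    (hW : VertexFamily₂ W n Cw δ) (hδ : 0 < δ) (μ ν : Fin 4) :
    |B12Beta.secondMoment (TOfLeg n A S W) μ ν| ≤ betaPrime510 4 (hessConst 4 (Fintype.card F) δ C Cv Cw) (δ / 4) :=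
  (secondMoment_abs_le_of_decay510 (P := TOfLeg n A S W) (by positivity) (decay510_TOfLeg n hn hA hV hW hδ μ ν)).2

/-- [folklore] `AbsMoment₂` of every channel, rates matched by monotonicity (needs the fibre inhabited to read the constants' signs). -/
theorem absMoment₂_TOfLeg [Inhabited F] (hn : 1 ≤ n) {δA δv δ2 : ℝ} (hA : Decays A C δA) (hδA : 0 < δA)
    (hV : VertexFamily (vertexRedF n S) n Cv δv) (hδv : 0 < δv) (hW : VertexFamily₂ W n Cw δ2) (hδ2 : 0 < δ2) (μ ν : Fin 4) :
    AbsMoment₂ (TOfLeg n A S W μ ν) := by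
  have hC : 0 ≤ C := hA.nonneg default
  have hCv : 0 ≤ Cv := (hV μ 0).nonneg default
  have hCw : 0 ≤ Cw := (hW μ 0 ν 0).nonneg default
  set δ' : ℝ := min δA (min δv δ2) with hδ'
  have hδ'pos : 0 < δ' := lt_min hδA (lt_min hδv hδ2)
  have hA' : Decays A C δ' := decays_mono hA hC le_rfl (min_le_left _ _)
  have hV' : VertexFamily (vertexRedF n S) n Cv δ' := fun μ' y =>
    biLoc_mono (hV μ' y) hCv ((min_le_right _ _).trans (min_le_left _ _))
  have hW' : VertexFamily₂ W n Cw δ' := fun μ' y ν' y' =>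
    biLoc_mono (hW μ' y ν' y') hCw ((min_le_right _ _).trans (min_le_right _ _))
  exact absMoment₂_hessKer hA' hV' hW' hδ'pos hn μ ν

end Generic

/-! ## §3 The GHOST instance over the typer's `Ggh` — leg-side decay unconditional -/

section Ghost

/-- [our object] **THE DRESSED GHOST ONE-SHOT KERNEL** `TOfGh n a S W := TOfLeg n (Ggh n a) S W` (fibre `Unit`; ghost stencils `S`, tables `W` =
T6's `Sgh/Wgh`; the loop weight of leaf R1 is applied by T7).  A DEFINITION; asserts nothing. -/
def TOfGh (n : ℕ) [NeZero n] (a : ℝ) (S : Fin 4 → Site 4 → MKer 4 Unit) (W : Fin 4 → Site 4 → Fin 4 → Site 4 → MKer 4 Unit) :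
    Fin 4 → Fin 4 → Site 4 → ℝ :=
  TOfLeg n (Ggh n a) S W

variable (a : ℝ) {S : Fin 4 → Site 4 → MKer 4 Unit} {W : Fin 4 → Site 4 → Fin 4 → Site 4 → MKer 4 Unit}

/-- [our object] Unfolding `TOfGh`. -/
theorem TOfGh_eq (S : Fin 4 → Site 4 → MKer 4 Unit) (W : Fin 4 → Site 4 → Fin 4 → Site 4 → MKer 4 Unit) :
    TOfGh n a S W = hessKer (Ggh n a) (vertexRedF n S) W := rfl

/-- [folklore] Block covariance of the ghost data (`covA` = the typer's `shiftK_Ggh_neg`, a theorem for `a > 0`). -/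
theorem blockCovariant_TOfGh (ha : 0 < a) (hS : ∀ (κ' : Fin 4) (u v : Site 4), S κ' (u + v) = shiftK (-v) (S κ' u))
    (hW : ∀ (μ : Fin 4) (y : Site 4) (ν : Fin 4) (y' t : Site 4), W μ (y + t) ν (y' + t) = shiftK (-((n : ℤ) • t)) (W μ y ν y')) :
    BlockCovariant (Ggh n a) (vertexRedF n S) W n :=
  blockCovariant_TOfLeg n (fun t => shiftK_Ggh_neg n a ha t) hS hW

/-- [folklore] **BASE POINT** for the ghost kernel. -/
theorem hess_Ggh_eq_TOfGh (ha : 0 < a) (hS : ∀ (κ' : Fin 4) (u v : Site 4), S κ' (u + v) = shiftK (-v) (S κ' u))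
    (hW : ∀ (μ : Fin 4) (y : Site 4) (ν : Fin 4) (y' t : Site 4), W μ (y + t) ν (y' + t) = shiftK (-((n : ℤ) • t)) (W μ y ν y'))
    (μ : Fin 4) (y : Site 4) (ν : Fin 4) (y' : Site 4) :
    hess (Ggh n a) (vertexRedF n S) W μ y ν y' = TOfGh n a S W μ ν (y' - y) :=
  hess_eq_TOfLeg n (fun t => shiftK_Ggh_neg n a ha t) hS hW μ y ν y'

/-- [folklore] **(5.10)-SHAPE DECAY OF THE GHOST KERNEL, NO LEG-SIDE HYPOTHESIS**: with the ghost leg's tree decay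
`Decays (Ggh n a) (2/min 2 a) (δ_u(4,a)/(4n))` and vertex/table data at a rate `δ ≤ δ_u(4,a)/(4n)`:
`Decay510 (TOfGh n a S W μ ν) (hessConst 4 1 δ (2/min 2 a) Cv Cw) (δ/4)` — constants PER `n` (the ghost rate is `∝ 1/n`). -/
theorem decay510_TOfGh (ha : 0 < a) {Cv Cw δ : ℝ} (hV : VertexFamily (vertexRedF n S) n Cv δ) (hW : VertexFamily₂ W n Cw δ)
    (hδ : 0 < δ) (hδ' : δ ≤ deltaU 4 a / (4 * (n : ℝ))) (μ ν : Fin 4) :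
    Decay510 (TOfGh n a S W μ ν) (hessConst 4 1 δ (2 / min 2 a) Cv Cw) (δ / 4) := by
  have hn : 1 ≤ n := Nat.one_le_iff_ne_zero.mpr (NeZero.ne n)
  have hA : Decays (Ggh n a) (2 / min 2 a) δ := decays_mono (decays_Ggh n a ha) (const_nonneg a ha) le_rfl hδ'
  have h := decay510_TOfLeg (F := Unit) n hn hA hV hW hδ μ ν
  simpa [TOfGh, Fintype.card_unit] using h

/-- [folklore] **THE GHOST KERNEL IS WELL-TYPED FOR EVERY VERTEX PAIR** (`AbsMoment₂` of every channel), NO leg-side hypothesis: vertex families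
at ANY positive rates. -/
theorem absMoment₂_TOfGh (ha : 0 < a) {Cv Cw δv δ2 : ℝ} (hV : VertexFamily (vertexRedF n S) n Cv δv) (hδv : 0 < δv)
    (hW : VertexFamily₂ W n Cw δ2) (hδ2 : 0 < δ2) (μ ν : Fin 4) : AbsMoment₂ (TOfGh n a S W μ ν) := by
  have hn : 1 ≤ n := Nat.one_le_iff_ne_zero.mpr (NeZero.ne n)
  have hn0 : (0 : ℝ) < n := by exact_mod_cast hn
  have hrate : 0 < deltaU 4 a / (4 * (n : ℝ)) := by have := deltaU_pos 4 ha; positivity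
  exact absMoment₂_TOfLeg (F := Unit) n hn (decays_Ggh n a ha) hrate hV hδv hW hδ2 μ ν

end Ghost

end Summit.QuantumFields.BalabanUV.Beta.D1BFx.ReducedKernelF

end
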